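import Summits.CriticalPhenomena.PercolationContinuityZ3.Theorems.PercNearOneGluingNoHeavyQuantSliceSingleLayerLaws
import HarnessLib

/-!
# QUANT lane R8, T-DEC: the FLOW CERTIFICATE for the transferred window-pair law of `LawDec.SliceLawSW` (case `h′ = h`, deep low) — four explicit
# flows on the positions `l, l+a → h, h+a` satisfying two capacity inequalities make `swLaw γ g t l h h a` DEC(j′) at the raised target (the capacities encode `0 ≤ t(1−g) ≤ γg`)

builds on p205010 (kernel theorem, internal audit signed; external expert review pending)

Support file (`--supports stmt-CriticalPhenomena-4575`), QUANT lane seat prim-quant-census-2 (gen 55), rung R8 of `run/shared/lean/prim/quant/LADDER.md`.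
Memo SINGLE-LAYER-G55 §3c.  Theorems only, standard axioms, no sorries.  Continues `…QuantSliceSingleLayerLaws` (`swLaw`, `SliceLawSW`, p311874),
`…QuantSliceMobiusIneq` (`mobius_IA`, `mobius_IB`, p311698), `…QuantLawDecMoveMidUp` (`decAtT_move_mid_up`, p311484).

WHAT THIS FILE DOES.  It removes the `Finset` bookkeeping from the remaining kernel work on `SliceLawSW`: for the law
`v = (1−γ)(1−g)δ_l + (1−γ)gδ_{l+a} + (γ+t)(1−g)δ_h + (γg − t(1−g))δ_{h+a}` (= `swLaw γ g t l h h a`) with a DEEP low (`2(l+a) < T′`), a slice mid `h`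
(`T′ ≤ 2h ≤ 2j′ < 2(h+a)`), `l + a + h > T′`, and flow amounts `f₁ : l+a → h`, `f₂ : l+a → h+a`, `f₃ : l → h` (only if `l + h > T′`), `f₄ : l → h+a` with
`f₁ + f₂ = (1−γ)g`, `f₃ + f₄ = (1−γ)(1−g)` and the two capacity inequalities `usage(l+a,h)·f₁ + usage(l,h)·f₃ ≤ (γ+t)(1−g)`,
`x/(1−x)·(f₂ + f₄) ≤ γg − t(1−g)`, the law is `DECAtT x T′ j′ (M+a)` (`swLaw_decAtT_of_flows`, via `decAtT_of_flowAtT`).  The three regimes of memo §3c are then: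
R1 (`f₂ = f₄ = 0`, `t = t₂`; inequality (I-B) = `mobius_IB`), R2 (`f₂ = f₃ = 0`, `t = t₁`; (I-A) = `mobius_IA`), R3A+ (`t = 0`, `f₂ = 0`; (I-C), memo) — assembling
them (linking `usage` to `lightUsage` on the light branch) closes the deep-light case; heavy pairs are `slice_heavyPair_decAtT` at `t = 0`; `h′ > h` is
`decAtT_move_mid_up`.

* `LawDec.swLaw_self_eq` — the values of `swLaw γ g t l h h a` at and off the four positions;  `LawDec.sum_swLaw_self` — total mass `1`.
* **`LawDec.swLaw_decAtT_of_flows`** — the flow certificate (DEEP low: both copies of `l` are slice lows).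
* **`LawDec.swLaw_decAtT_of_flows_shallow`** — the sibling for a SHALLOW low (`T′ ≤ 2(l+a)`: the row-1 copy is a slice mid and serves as the vertical
  partner; one low, absorbers `h`, `l+a`, giant; `h ≠ l + a`).  Memo §3d (ii): the one-low capacity inequality (II-0)/(II-t) decides like the LP on 141 607
  instances, 0 failures — this lemma is its certificate.

[this work].  The gluing rows served [cite: KozmaNitzan2024, Conjecture 3 (p. 15)]; product measure [cite: Grimmett1999, §1.3 p. 10].
-/

noncomputable section

namespace Summit.CriticalPhenomena.PercolationContinuityZ3.Theorems

namespace Quant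

open Finset

namespace LawDec

/-- the transferred law with `h′ = h`, as a single combination of four indicators. [this work] -/
theorem swLaw_self_eq (γ g t : ℝ) (l h a p : ℕ) :
    swLaw γ g t l h h a p = (1 - γ) * (1 - g) * (if p = l then (1 : ℝ) else 0) + (1 - γ) * g * (if p = l + a then (1 : ℝ) else 0)
      + (γ + t) * (1 - g) * (if p = h then (1 : ℝ) else 0) + (γ * g - t * (1 - g)) * (if p = h + a then (1 : ℝ) else 0) := by
  simp only [swLaw]
  ring

/-- total mass of the transferred law on `{0..N}` (`h + a ≤ N`, `l + a ≤ N`). [this work] -/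
theorem sum_swLaw_self (γ g t : ℝ) (l h a N : ℕ) (hl : l + a ≤ N) (hh : h + a ≤ N) :
    ∑ p ∈ Finset.range (N + 1), swLaw γ g t l h h a p = 1 := by
  have := sum_coef_swLaw (fun _ => (1 : ℝ)) N γ g t l h h a hl hh (by omega)
  simp only [one_mul] at this
  rw [this]
  ring

/-- **THE FLOW CERTIFICATE** (memo SINGLE-LAYER-G55 §3c).  See the file header. [this work] -/
theorem swLaw_decAtT_of_flows (x g T γ t : ℝ) (M a j' l h : ℕ) (f₁ f₂ f₃ f₄ : ℝ)
    (hx0 : 0 < x) (hx1 : x < 1)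
    (hlah : l + a < h) (hhj : h ≤ j') (hjh : j' < h + a) (hhM : h ≤ M)
    (hdeep : 2 * (((l + a : ℕ) : ℝ)) < T + (a : ℝ) * g) (hmid : T + (a : ℝ) * g ≤ 2 * (h : ℝ))
    (hcomp1 : T + (a : ℝ) * g < ((l + a : ℕ) : ℝ) + h)
    (hf1 : 0 ≤ f₁) (hf2 : 0 ≤ f₂) (hf3 : 0 ≤ f₃) (hf4 : 0 ≤ f₄)
    (hrow1 : f₁ + f₂ = (1 - γ) * g) (hrow0 : f₃ + f₄ = (1 - γ) * (1 - g))
    (hcomp0 : 0 < f₃ → T + (a : ℝ) * g < (l : ℝ) + h)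
    (hcapMid : usage x (T + (a : ℝ) * g) j' (l + a) h * f₁ + usage x (T + (a : ℝ) * g) j' l h * f₃ ≤ (γ + t) * (1 - g))
    (hcapGiant : x / (1 - x) * (f₂ + f₄) ≤ γ * g - t * (1 - g)) :
    DECAtT x (T + (a : ℝ) * g) j' (M + a) (swLaw γ g t l h h a) := by
  classical
  set T' : ℝ := T + (a : ℝ) * g with hT'
  -- distinct positions
  have hl_la : l ≠ l + a := by
    intro e
    have : a = 0 := by omega
    subst this
    simp at hjh hhj
    omega
  have ha0 : 0 < a := by
    by_contra hz
    have : a = 0 := by omega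
    exact hl_la (by rw [this, add_zero])
  have hl_h : l ≠ h := by omega
  have hl_ha : l ≠ h + a := by omega
  have hla_h : l + a ≠ h := by omega
  have hla_ha : l + a ≠ h + a := by omega
  have hh_ha : h ≠ h + a := by omega
  have hlj : l ≤ j' := by omega
  have hlowl : 2 * (l : ℝ) < T' := by
    have : (l : ℝ) ≤ ((l + a : ℕ) : ℝ) := by exact_mod_cast Nat.le_add_right l a
    linarith
  -- the flows
  let f : ℕ → ℕ → ℝ := fun p q =>
    if p = l + a ∧ q = h then f₁ else if p = l + a ∧ q = h + a then f₂ else if p = l ∧ q = h then f₃ else if p = l ∧ q = h + a then f₄ else 0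
  have hflow : FlowAtT x T' j' (M + a) (swLaw γ g t l h h a) := by
    refine ⟨f, ?_, ?_, ?_, ?_⟩
    · -- nonnegativity
      intro p q; simp only [f]; split_ifs <;> first | assumption | exact le_rfl
    · -- support
      intro p q hpos
      simp only [f] at hpos
      by_cases c1 : p = l + a ∧ q = h
      · rw [c1.1, c1.2]; exact ⟨by omega, hdeep, by omega, Or.inr hcomp1⟩
      · rw [if_neg c1] at hpos
        by_cases c2 : p = l + a ∧ q = h + a
        · rw [c2.1, c2.2]; exact ⟨by omega, hdeep, by omega, Or.inl (by omega)⟩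
        · rw [if_neg c2] at hpos
          by_cases c3 : p = l ∧ q = h
          · rw [if_pos c3] at hpos
            rw [c3.1, c3.2]; exact ⟨hlj, hlowl, by omega, Or.inr (hcomp0 hpos)⟩
          · rw [if_neg c3] at hpos
            by_cases c4 : p = l ∧ q = h + a
            · rw [c4.1, c4.2]; exact ⟨hlj, hlowl, by omega, Or.inl (by omega)⟩
            · rw [if_neg c4] at hpos; exact absurd hpos (lt_irrefl _)
    · -- every low is shipped exactly
      intro p hpj hplow
      have hph : p ≠ h := by intro e; rw [e] at hplow; linarith
      have hpha : p ≠ h + a := by omega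
      rw [swLaw_self_eq, if_neg hph, if_neg hpha]
      by_cases hp : p = l + a
      · subst hp
        rw [if_neg (Ne.symm hl_la), if_pos rfl]
        have e : ∀ q ∈ Finset.range (M + a + 1), f (l + a) q
            = f₁ * (if q = h then (1 : ℝ) else 0) + f₂ * (if q = h + a then (1 : ℝ) else 0) := by
          intro q _
          simp only [f, true_and]
          by_cases qh : q = h
          · rw [if_pos qh, if_pos qh, if_neg (by omega)]; ring
          · rw [if_neg qh, if_neg qh]
            by_cases qha : q = h + a
            · rw [if_pos qha, if_pos qha]; ring
            · rw [if_neg qha, if_neg qha, if_neg (fun hc => hl_la hc.1.symm), if_neg (fun hc => hl_la hc.1.symm)]; ring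
        rw [Finset.sum_congr rfl e, Finset.sum_add_distrib, ← Finset.mul_sum, ← Finset.mul_sum,
          Finset.sum_ite_eq' (Finset.range (M + a + 1)) h, Finset.sum_ite_eq' (Finset.range (M + a + 1)) (h + a),
          if_pos (Finset.mem_range.2 (by omega)), if_pos (Finset.mem_range.2 (by omega))]
        linarith [hrow1]
      · by_cases hp' : p = l
        · subst hp'
          rw [if_pos rfl, if_neg hl_la]
          have e : ∀ q ∈ Finset.range (M + a + 1), f p q
              = f₃ * (if q = h then (1 : ℝ) else 0) + f₄ * (if q = h + a then (1 : ℝ) else 0) := by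
            intro q _
            simp only [f, true_and]
            rw [if_neg (fun hc => hp hc.1), if_neg (fun hc => hp hc.1)]
            by_cases qh : q = h
            · rw [if_pos qh, if_pos qh, if_neg (by omega)]; ring
            · rw [if_neg qh, if_neg qh]
              by_cases qha : q = h + a
              · rw [if_pos qha, if_pos qha]; ring
              · rw [if_neg qha, if_neg qha]; ring
          rw [Finset.sum_congr rfl e, Finset.sum_add_distrib, ← Finset.mul_sum, ← Finset.mul_sum,
            Finset.sum_ite_eq' (Finset.range (M + a + 1)) h, Finset.sum_ite_eq' (Finset.range (M + a + 1)) (h + a),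
            if_pos (Finset.mem_range.2 (by omega)), if_pos (Finset.mem_range.2 (by omega))]
          linarith [hrow0]
        · rw [if_neg hp', if_neg hp]
          have e : ∀ q ∈ Finset.range (M + a + 1), f p q = 0 := by
            intro q _
            simp only [f]
            rw [if_neg (fun hc => hp hc.1), if_neg (fun hc => hp hc.1), if_neg (fun hc => hp' hc.1), if_neg (fun hc => hp' hc.1)]
          rw [Finset.sum_congr rfl e, Finset.sum_const_zero]; ring
    · -- capacities
      intro q hqM hq
      rw [swLaw_self_eq]
      have hql : q ≠ l := by
        rintro rfl
        rcases hq with hq | hq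
        · omega
        · linarith
      have hqla : q ≠ l + a := by
        rintro rfl
        rcases hq with hq | hq
        · omega
        · linarith
      rw [if_neg hql, if_neg hqla]
      by_cases qh : q = h
      · subst qh
        rw [if_pos rfl, if_neg hh_ha]
        have e : ∀ p ∈ Finset.range (j' + 1), usage x T' j' p q * f p q
            = (usage x T' j' (l + a) q * f₁) * (if p = l + a then (1 : ℝ) else 0) + (usage x T' j' l q * f₃) * (if p = l then (1 : ℝ) else 0) := by
          intro p _
          simp only [f, and_true]
          by_cases pla : p = l + a
          · rw [if_pos pla, if_pos pla, if_neg (fun e => hl_la (e.symm.trans pla)), pla]; ring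
          · rw [if_neg pla, if_neg (fun hc => hh_ha hc.2), if_neg pla]
            by_cases pl : p = l
            · rw [if_pos pl, if_pos pl, pl]; ring
            · rw [if_neg pl, if_neg (fun hc => pl hc.1), if_neg pl]; ring
        rw [Finset.sum_congr rfl e, Finset.sum_add_distrib, ← Finset.mul_sum, ← Finset.mul_sum,
          Finset.sum_ite_eq' (Finset.range (j' + 1)) (l + a), Finset.sum_ite_eq' (Finset.range (j' + 1)) l,
          if_pos (Finset.mem_range.2 (by omega)), if_pos (Finset.mem_range.2 (by omega))]
        linarith
      · by_cases qha : q = h + a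
        · subst qha
          rw [if_neg qh, if_pos rfl]
          have hgi : j' + 1 ≤ h + a := by omega
          have e : ∀ p ∈ Finset.range (j' + 1), usage x T' j' p (h + a) * f p (h + a)
              = (x / (1 - x) * f₂) * (if p = l + a then (1 : ℝ) else 0) + (x / (1 - x) * f₄) * (if p = l then (1 : ℝ) else 0) := by
            intro p _
            rw [usage_giant_eq x T' j' p (h + a) hgi]
            simp only [f, and_true]
            by_cases pla : p = l + a
            · rw [if_neg (fun hc => hh_ha hc.2.symm), if_pos pla, if_pos pla, if_neg (fun e => hl_la (e.symm.trans pla))]; ring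
            · rw [if_neg (fun hc => pla hc.1), if_neg pla, if_neg pla]
              by_cases pl : p = l
              · rw [if_neg (fun hc => hh_ha hc.2.symm), if_pos pl, if_pos pl]; ring
              · rw [if_neg (fun hc => pl hc.1), if_neg pl, if_neg pl]; ring
          rw [Finset.sum_congr rfl e, Finset.sum_add_distrib, ← Finset.mul_sum, ← Finset.mul_sum,
            Finset.sum_ite_eq' (Finset.range (j' + 1)) (l + a), Finset.sum_ite_eq' (Finset.range (j' + 1)) l,
            if_pos (Finset.mem_range.2 (by omega)), if_pos (Finset.mem_range.2 (by omega))]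
          linarith
        · rw [if_neg qh, if_neg qha]
          have e : ∀ p ∈ Finset.range (j' + 1), usage x T' j' p q * f p q = 0 := by
            intro p _
            simp only [f]
            rw [if_neg (fun hc => qh hc.2), if_neg (fun hc => qha hc.2), if_neg (fun hc => qh hc.2), if_neg (fun hc => qha hc.2), mul_zero]
          rw [Finset.sum_congr rfl e, Finset.sum_const_zero]; ring_nf; exact le_rfl
  -- law facts and conclusion
  refine decAtT_of_flowAtT x T' j' (M + a) _ hx0 hx1 (fun p hp => ?_) ?_ hflow
  · rw [swLaw_self_eq, if_neg (by omega), if_neg (by omega), if_neg (by omega), if_neg (by omega)]; ring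
  · exact sum_swLaw_self γ g t l h a (M + a) (by omega) (by omega)

/-- **THE FLOW CERTIFICATE, SHALLOW LOW** (memo SINGLE-LAYER-G55 §3d (ii)).  See the file header. [this work] -/
theorem swLaw_decAtT_of_flows_shallow (x g T γ t : ℝ) (M a j' l h : ℕ) (fh fv fg : ℝ)
    (hx0 : 0 < x) (hx1 : x < 1)
    (hlh : l < h) (hhla : h ≠ l + a) (ha : 1 ≤ a) (hhj : h ≤ j') (hjh : j' < h + a) (hhM : h ≤ M) (hlaj : l + a ≤ j')
    (hlowl : 2 * (l : ℝ) < T + (a : ℝ) * g) (hshallow : T + (a : ℝ) * g ≤ 2 * (((l + a : ℕ) : ℝ))) (hmid : T + (a : ℝ) * g ≤ 2 * (h : ℝ))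
    (hfh : 0 ≤ fh) (hfv : 0 ≤ fv) (hfg : 0 ≤ fg) (hsum : fh + fv + fg = (1 - γ) * (1 - g))
    (hcomph : 0 < fh → T + (a : ℝ) * g < (l : ℝ) + h) (hcompv : 0 < fv → T + (a : ℝ) * g < (l : ℝ) + ((l + a : ℕ) : ℝ))
    (hcaph : usage x (T + (a : ℝ) * g) j' l h * fh ≤ (γ + t) * (1 - g))
    (hcapv : usage x (T + (a : ℝ) * g) j' l (l + a) * fv ≤ (1 - γ) * g)
    (hcapg : x / (1 - x) * fg ≤ γ * g - t * (1 - g)) :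
    DECAtT x (T + (a : ℝ) * g) j' (M + a) (swLaw γ g t l h h a) := by
  classical
  set T' : ℝ := T + (a : ℝ) * g with hT'
  have ha0 : 0 < a := by omega
  have hl_la : l ≠ l + a := by omega
  have hl_h : l ≠ h := by omega
  have hl_ha : l ≠ h + a := by omega
  have hla_h : l + a ≠ h := fun e => hhla e.symm
  have hla_ha : l + a ≠ h + a := by omega
  have hh_ha : h ≠ h + a := by omega
  have hlj : l ≤ j' := by omega
  let f : ℕ → ℕ → ℝ := fun p q =>
    if p = l ∧ q = h then fh else if p = l ∧ q = l + a then fv else if p = l ∧ q = h + a then fg else 0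
  have hflow : FlowAtT x T' j' (M + a) (swLaw γ g t l h h a) := by
    refine ⟨f, ?_, ?_, ?_, ?_⟩
    · intro p q; simp only [f]; split_ifs <;> first | assumption | exact le_rfl
    · intro p q hpos
      simp only [f] at hpos
      by_cases c1 : p = l ∧ q = h
      · rw [if_pos c1] at hpos
        rw [c1.1, c1.2]; exact ⟨hlj, hlowl, by omega, Or.inr (hcomph hpos)⟩
      · rw [if_neg c1] at hpos
        by_cases c2 : p = l ∧ q = l + a
        · rw [if_pos c2] at hpos
          rw [c2.1, c2.2]; exact ⟨hlj, hlowl, by omega, Or.inr (hcompv hpos)⟩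
        · rw [if_neg c2] at hpos
          by_cases c3 : p = l ∧ q = h + a
          · rw [c3.1, c3.2]; exact ⟨hlj, hlowl, by omega, Or.inl (by omega)⟩
          · rw [if_neg c3] at hpos; exact absurd hpos (lt_irrefl _)
    · -- the only low among the four positions is l
      intro p hpj hplow
      have hph : p ≠ h := by intro e; rw [e] at hplow; linarith
      have hpha : p ≠ h + a := by omega
      have hpla : p ≠ l + a := by intro e; rw [e] at hplow; linarith
      rw [swLaw_self_eq, if_neg hph, if_neg hpha, if_neg hpla]
      by_cases hp : p = l
      · subst hp
        rw [if_pos rfl]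
        have e : ∀ q ∈ Finset.range (M + a + 1), f p q
            = fh * (if q = h then (1 : ℝ) else 0) + fv * (if q = p + a then (1 : ℝ) else 0) + fg * (if q = h + a then (1 : ℝ) else 0) := by
          intro q _
          simp only [f, true_and]
          by_cases qh : q = h
          · rw [if_pos qh, if_pos qh, if_neg (by omega), if_neg (by omega)]; ring
          · rw [if_neg qh, if_neg qh]
            by_cases qla : q = p + a
            · rw [if_pos qla, if_pos qla, if_neg (by omega)]; ring
            · rw [if_neg qla, if_neg qla]
              by_cases qha : q = h + a
              · rw [if_pos qha, if_pos qha]; ring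
              · rw [if_neg qha, if_neg qha]; ring
        rw [Finset.sum_congr rfl e, Finset.sum_add_distrib, Finset.sum_add_distrib, ← Finset.mul_sum, ← Finset.mul_sum, ← Finset.mul_sum,
          Finset.sum_ite_eq' (Finset.range (M + a + 1)) h, Finset.sum_ite_eq' (Finset.range (M + a + 1)) (p + a),
          Finset.sum_ite_eq' (Finset.range (M + a + 1)) (h + a),
          if_pos (Finset.mem_range.2 (by omega)), if_pos (Finset.mem_range.2 (by omega)), if_pos (Finset.mem_range.2 (by omega))]
        linarith [hsum]
      · rw [if_neg hp]
        have e : ∀ q ∈ Finset.range (M + a + 1), f p q = 0 := by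
          intro q _
          simp only [f]
          rw [if_neg (fun hc => hp hc.1), if_neg (fun hc => hp hc.1), if_neg (fun hc => hp hc.1)]
        rw [Finset.sum_congr rfl e, Finset.sum_const_zero]; ring
    · -- capacities
      intro q hqM hq
      rw [swLaw_self_eq]
      have hql : q ≠ l := by
        rintro rfl
        rcases hq with hq | hq
        · omega
        · linarith
      rw [if_neg hql]
      by_cases qh : q = h
      · rw [if_neg (by omega : q ≠ l + a), if_pos qh, if_neg (by omega : q ≠ h + a)]
        have e : ∀ p ∈ Finset.range (j' + 1), usage x T' j' p q * f p q
            = (usage x T' j' l q * fh) * (if p = l then (1 : ℝ) else 0) := by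
          intro p _
          simp only [f]
          by_cases pl : p = l
          · rw [if_pos ⟨pl, qh⟩, if_pos pl, pl]; ring
          · rw [if_neg (fun hc => pl hc.1), if_neg (fun hc => pl hc.1), if_neg (fun hc => pl hc.1), if_neg pl]; ring
        rw [Finset.sum_congr rfl e, ← Finset.mul_sum, Finset.sum_ite_eq' (Finset.range (j' + 1)) l, if_pos (Finset.mem_range.2 (by omega))]
        rw [qh]; linarith
      · by_cases qla : q = l + a
        · rw [if_pos qla, if_neg qh, if_neg (by omega : q ≠ h + a)]
          have e : ∀ p ∈ Finset.range (j' + 1), usage x T' j' p q * f p q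
              = (usage x T' j' l q * fv) * (if p = l then (1 : ℝ) else 0) := by
            intro p _
            simp only [f]
            by_cases pl : p = l
            · rw [if_neg (fun hc => qh hc.2), if_pos ⟨pl, qla⟩, if_pos pl, pl]; ring
            · rw [if_neg (fun hc => pl hc.1), if_neg (fun hc => pl hc.1), if_neg (fun hc => pl hc.1), if_neg pl]; ring
          rw [Finset.sum_congr rfl e, ← Finset.mul_sum, Finset.sum_ite_eq' (Finset.range (j' + 1)) l, if_pos (Finset.mem_range.2 (by omega))]
          rw [qla]; linarith
        · by_cases qha : q = h + a
          · rw [if_neg qla, if_neg qh, if_pos qha]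
            have hgi : j' + 1 ≤ q := by omega
            have e : ∀ p ∈ Finset.range (j' + 1), usage x T' j' p q * f p q
                = (x / (1 - x) * fg) * (if p = l then (1 : ℝ) else 0) := by
              intro p _
              rw [usage_giant_eq x T' j' p q hgi]
              simp only [f]
              by_cases pl : p = l
              · rw [if_neg (fun hc => qh hc.2), if_neg (fun hc => qla hc.2), if_pos ⟨pl, qha⟩, if_pos pl]; ring
              · rw [if_neg (fun hc => pl hc.1), if_neg (fun hc => pl hc.1), if_neg (fun hc => pl hc.1), if_neg pl]; ring
            rw [Finset.sum_congr rfl e, ← Finset.mul_sum, Finset.sum_ite_eq' (Finset.range (j' + 1)) l, if_pos (Finset.mem_range.2 (by omega))]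
            linarith
          · rw [if_neg qla, if_neg qh, if_neg qha]
            have e : ∀ p ∈ Finset.range (j' + 1), usage x T' j' p q * f p q = 0 := by
              intro p _
              simp only [f]
              rw [if_neg (fun hc => qh hc.2), if_neg (fun hc => qla hc.2), if_neg (fun hc => qha hc.2), mul_zero]
            rw [Finset.sum_congr rfl e, Finset.sum_const_zero]; ring_nf; exact le_rfl
  refine decAtT_of_flowAtT x T' j' (M + a) _ hx0 hx1 (fun p hp => ?_) ?_ hflow
  · rw [swLaw_self_eq, if_neg (by omega), if_neg (by omega), if_neg (by omega), if_neg (by omega)]; ring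
  · exact sum_swLaw_self γ g t l h a (M + a) (by omega) (by omega)

end LawDec

end Quant

end Summit.CriticalPhenomena.PercolationContinuityZ3.Theorems
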